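import Summits.ResolutionOfSingularities.ResolutionOfSingularities.Theses.WildPurity
import Summits.ResolutionOfSingularities.ResolutionOfSingularities.Theorems.WildPurityPurityTransferStubRegularChart
import Summits.ResolutionOfSingularities.ResolutionOfSingularities.Theorems.WildPurityPurityTransferStubHeightOneValuationRing
import Summits.ResolutionOfSingularities.ResolutionOfSingularities.Theorems.WildPurityPurityTransferStubGerstenTransport
import Literature.AlgebraicGeometry.Resolution.ResolutionLU
import Literature.AlgebraicGeometry.Resolution.DivisorialPlace
import Literature.NumberTheory.GaloisCohomology.KatoCohomologyPurity
import HarnessLib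

/-!
# Crux `PurityTransfer` (stmt-ResolutionOfSingularities-17142) closed MODULO the named fact
# `Shiho2007_purity` — line `birth` of `Cruxes/PurityTransfer/`

Route `ResolutionOfSingularities/WildPurity` (refutation-shaped), crux #3 `PurityTransfer` (Kato valuative
purity above a resolvable affine model): for `p` prime, `k` perfect of characteristic `p`, `K/k` finitely
generated, `O ⊇ k` a valuation ring of `K` and `R ⊆ O` a finitely generated `k`-subalgebra with
`Frac R = K`, if `Spec R` has a resolution of singularities then every class `α` of the symbolic Kato group
`H³_p(K) = G ⧸ N` that is `W`-integral at every divisorial place `W ⊇ R` of `K/k` whose centre on `R` lies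
inside the centre of `O` is `O`-integral.

## What is proved here

`PurityTransfer_of_shiho2007 : Shiho2007_purity.{0} → PurityTransfer` — the crux CONDITIONAL on exactly one
named fact of the tree, `Literature.NumberTheory.GaloisCohomology.Shiho2007_purity` (Gersten's conjecture for
the logarithmic Hodge–Witt sheaf over regular local rings of characteristic `p`, in Kato's symbolic
presentation: `⋂_{ht P = 1} Unr(A_P) ≤ Unr(A)`; Gros–Suwa 1988, Thm. 1.4, for localizations of smooth
schemes over perfect fields, Shiho 2007, Thm. 4.1, in general).  The three geometric/bookkeeping stubs of
the line are landed theorems (imported): `stub_regularChart` (regularity at the centre of `O` spreads to a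
finitely generated chart inside `O`, by J-2 openness), `stub_heightOneValuationRing` (regular local of
dimension one is a valuation ring) and `stub_gerstenTransport` (the named fact at `n = 2`, moved to the
crux's pair presentation `H3Pair p K` / `pairIntegral` at the local ring `localizationIn K 𝔮`).

Proof of the composition: unpack the crux; the landed valuative-criterion lift
`exists_affineModel_regular_of_hasResolution` (this is where the load-bearing binder `R ⊆ O` enters — cf.
`Theorems/PurityTransfer/Negative/FalseWithoutLe.lean`) turns `HasResolution (Spec R)` into a finitely
generated `R ⊆ A ⊆ O` regular at the centre; `stub_regularChart` enlarges it to a chart `A' ⊆ O` regular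
at every prime; `stub_gerstenTransport` at `𝔮 := 𝔪_O ∩ A'` asks for integrality of `α` at the local rings
`A'_P` (`ht P = 1`, `P ⊆ 𝔮`), which the crux hypothesis grants at the divisorial place
`W := placeOfPrime A' P _` (a valuation ring by `stub_heightOneValuationRing`; `W` contains `k` and `R`, is a
discrete valuation ring, is essentially of finite type over `k` with model `A'`, and has centre on `R`
inside the centre of `O` because `x ∈ R ∩ P ⊆ 𝔮`); the resulting `α ∈ Unr(A'_𝔮)` gives `α ∈ Unr(O)` by
local domination `A'_𝔮 ⊆ O` and monotonicity of `Unr`.  The crux's `let G ⧸ N` is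
`KatoCohomologySymbolic.H3Pair p K` and its `let Unr T` is `KatoCohomologySymbolic.pairIntegral p ↑T`,
DEFINITIONALLY, and the carrier of `placeOfPrime A' P _` is that of `localizationIn K P`, also
definitionally — so no comparison lemma is needed.

Also: `PurityTransfer_of_grosSuwa1988 : GrosSuwa1988_purity.{0} → PurityTransfer` — the same composition from the
WEAKER named fact `Literature.NumberTheory.GaloisCohomology.GrosSuwa1988_purity` (the smooth case over a perfect
field, Gros–Suwa 1988 Thm. 1.4, which is all the composition consumes; implied by `Shiho2007_purity`).

## What is NOT here

The discharge of `Shiho2007_purity` (de Rham complex in degree 2, inverse Cartier operator, Bloch–Kato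
Lemma 4.2, Gros–Suwa's Cousin-complex argument — none in Mathlib).  When `Shiho2007_purity_holds` lands,
`PurityTransfer` follows by one application (to be appended here).
-/

noncomputable section

-- single-problem summit: the doubled namespace component `ResolutionOfSingularities` is forced
set_option linter.dupNamespace false

open AlgebraicGeometry Literature.AlgebraicGeometry.Resolution
open Literature.NumberTheory.GaloisCohomology
open Literature.NumberTheory.GaloisCohomology.KatoCohomologySymbolic
open Summit.ResolutionOfSingularities.ResolutionOfSingularities.Theses.WildPurity (PurityTransfer)

namespace Summit.ResolutionOfSingularities.ResolutionOfSingularities.Theorems.WildPurityPurityTransfer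

/-- `pairIntegral` (the crux's `Unr`) is monotone in the set of admissible coefficients. [folklore] -/
theorem pairIntegral_mono (p : ℕ) {K : Type} [Field K] {T T' : Set K} (h : T ⊆ T') :
    pairIntegral p T ≤ pairIntegral p T' :=
  AddSubgroup.closure_mono fun _ ⟨a, b, c, ha, hb, hb', hc, hc', hy⟩ =>
    ⟨a, b, c, h ha, h hb, h hb', h hc, h hc', hy⟩

/-- **Local domination**: the local ring `A_𝔮 ⊆ K` of an affine model `A ⊆ O` at the centre
`𝔮 = 𝔪_O ∩ A` of the valuation ring `O` lies inside `O` (`a / s` with `s ∈ A` off the centre: `s` is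
a unit of `O`). [folklore] -/
theorem localizationIn_centre_subset {k K : Type} [Field k] [Field K] [Algebra k K]
    (O : ValuationSubring K) (A : Subalgebra k K) [IsFractionRing A K]
    (h : A.toSubring ≤ O.toSubring) :
    (localizationIn K (centreIdeal A O h) : Set K) ⊆ O := by
  intro x hx
  obtain ⟨a, s, hs, rfl⟩ :
      ∃ (a s : A) (_ : s ∈ (centreIdeal A O h).primeCompl),
        x = algebraMap A K a * (algebraMap A K s)⁻¹ := hx
  exact mul_mem (h a.2) (inv_mem_of_notMem_centreIdeal O A h hs)

/-- **The crux `PurityTransfer` conditional on the named fact `Shiho2007_purity`** (Gersten purity for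
Kato's `H^{n+1}_p` over regular local rings of characteristic `p`, symbolic form; Gros–Suwa 1988 /
Shiho 2007): Kato valuative purity above a resolvable affine model.  Proof: valuative-criterion lift to
the regular model (`exists_affineModel_regular_of_hasResolution`), regular chart inside `O`
(`stub_regularChart`), Gersten purity at the centre transported to the pair presentation
(`stub_gerstenTransport`, fed with the fact), admissibility of the prime divisors through the centre
(`stub_heightOneValuationRing`, `placeOfPrime`), local domination `A'_𝔮 ⊆ O`.
[cite: Shiho2007, Thm. 4.1; GrosSuwa1988, Thm. 1.4; ZariskiSamuel1960, Ch. VI §14, Thm. 31] -/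
theorem PurityTransfer_of_shiho2007 (hS : Shiho2007_purity.{0}) : PurityTransfer := by
  intro p hp k K _ _ _ _ _ _hKfg O _hO R hR hRO hfr hres G N Unr α hdiv
  -- (1) landed: the valuative criterion of properness lifts `Spec O` to the regular model
  obtain ⟨A, hAO, hRA, hAfg, hreg⟩ :=
    exists_affineModel_regular_of_hasResolution O R hRO hR hfr hres
  have hAfr : IsFractionRing A K := isFractionRing_of_le hRA hfr
  -- (2) spread regularity to an affine chart `A'` inside `O`
  obtain ⟨A', hAA', hA'O, hA'fg, hreg'⟩ := stub_regularChart k K O A hAO hAfg hAfr hreg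
  haveI hA'fr : IsFractionRing A' K := isFractionRing_of_le hAA' hAfr
  -- (3) Gersten purity at the centre `𝔮 = 𝔪_O ∩ A'`: the local rings `A'_P`, `ht P = 1`, `P ⊆ 𝔮`,
  --     are (the carriers of) admissible divisorial places for the crux's hypothesis
  have key : α ∈ pairIntegral p (localizationIn K (centreIdeal A' O hA'O) : Set K) := by
    refine stub_gerstenTransport hS p hp k K A' (centreIdeal A' O hA'O) (hreg' _) α ?_
    intro P _ hP1 hPle
    have hPval : ValuationRing (Localization.AtPrime P) :=
      stub_heightOneValuationRing k K A' P (hreg' P) hP1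
    -- the crux hypothesis at `W := placeOfPrime A' P hPval`, whose carrier is `localizationIn K P`
    exact hdiv (placeOfPrime A' P hPval) (algebraMap_mem_placeOfPrime A' P hPval)
      (isDiscreteValuationRing_placeOfPrime A' P hPval hA'fg (Ideal.ne_bot_of_height_eq_one hP1))
      ⟨A', hA'fg, le_placeOfPrime A' P hPval,
        fun x hx => exists_mul_eq_of_mem_placeOfPrime A' P hPval hx⟩
      (fun x hx => le_placeOfPrime A' P hPval (hAA' (hRA hx)))
      (fun x hxR hxW =>
        (mem_centreIdeal_iff_coe_mem_nonunits A' O hA'O ⟨x, hAA' (hRA hxR)⟩).mp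
          (hPle ((coe_mem_nonunits_placeOfPrime_iff A' P hPval ⟨x, hAA' (hRA hxR)⟩).mp hxW)))
  -- (4) local domination `A'_𝔮 ⊆ O` and monotonicity of `Unr`
  exact pairIntegral_mono p (localizationIn_centre_subset O A' hA'O) key

/-! ## The crux conditional on the SMOOTH CASE only (Gros–Suwa 1988)

`PurityTransfer_of_shiho2007` above depends on `Shiho2007_purity` (all regular local `𝔽_p`-algebras).  What
the composition actually consumes is purity at the local ring `A'_𝔮` of an affine model `A'` finitely
generated over the PERFECT field `k` and regular at `𝔮` — a localization of a smooth `k`-scheme, i.e. the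
Gros–Suwa case, recorded in the tree as the weaker named fact
`Literature.NumberTheory.GaloisCohomology.GrosSuwa1988_purity` (implied by `Shiho2007_purity`:
`grosSuwa1988_purity_of_shiho2007`).  The two theorems below redo the transport and the composition from
that weaker hypothesis, so that the crux's recorded dependency is exactly the smooth case. -/

/-- **Gersten purity at `A_𝔮` in the pair presentation, from the smooth-case fact `GrosSuwa1988_purity`**:
for `p` prime, `k` perfect of characteristic `p`, `A ⊆ K` a finitely generated `k`-subalgebra with
`Frac A = K` and `𝔮` a prime of `A` with `A_𝔮` regular, a class `α ∈ H³_p(K)` (`H3Pair p K`) that is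
`A_P`-integral for every height-one prime `P ⊆ 𝔮` is `A_𝔮`-integral.  Proof: the fact at `(B, 𝔮, n) :=
(A, 𝔮, 2)` gives `heightOneIntegralSymbols p 2 A_𝔮 K ≤ Unr(A_𝔮)`; the height-one primes `P'` of
`A_𝔮 ⊆ K` contract to height-one primes `P' ∩ A ⊆ 𝔮` (`IsLocalization.height_under`,
`under_localizationIn_le`) with `A_{P' ∩ A} ⊆ (A_𝔮)_{P'}` (`localizationIn_under_subset_localizationIn`),
and `mem_pairIntegral_iff` translates between `H3Pair p K` and `KatoCohomologySymbolic p K 2`.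
[cite: GrosSuwa1988, Thm. 1.4] -/
theorem gerstenTransport_of_grosSuwa1988 (hGS : GrosSuwa1988_purity.{0}) (p : ℕ) (hp : p.Prime)
    (k K : Type) [Field k] [CharP k p] [PerfectField k] [Field K] [Algebra k K] (A : Subalgebra k K)
    [IsFractionRing A K] (hfg : A.FG) (𝔮 : Ideal A) [𝔮.IsPrime]
    (hreg : IsRegularLocalRing (Localization.AtPrime 𝔮)) (α : H3Pair p K)
    (hα : ∀ (P : Ideal A) [P.IsPrime], P.height = 1 → P ≤ 𝔮 →
      α ∈ pairIntegral p (localizationIn K P : Set K)) :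
    α ∈ pairIntegral p (localizationIn K 𝔮 : Set K) := by
  haveI : IsLocalization.AtPrime (localizationIn K 𝔮) 𝔮 :=
    Localization.subalgebra.isLocalization_ofField K 𝔮.primeCompl 𝔮.primeCompl_le_nonZeroDivisors
  have h1 : heightOneIntegralSymbols p 2 (localizationIn K 𝔮) K ≤
      integralSymbols p 2 (localizationIn K 𝔮 : Set K) :=
    hGS p hp k K A hfg 𝔮 hreg 2
  refine (mem_pairIntegral_iff p _ α).2
    (h1 ((mem_heightOneIntegralSymbols_iff _).2 fun P' _ hP' => ?_))
  have hP1 : (P'.under A).height = 1 := by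
    rw [IsLocalization.height_under 𝔮.primeCompl P']
    exact hP'
  exact integralSymbols_mono p (localizationIn_under_subset_localizationIn 𝔮 P')
    ((mem_pairIntegral_iff p _ α).1 (hα (P'.under A) hP1 (under_localizationIn_le 𝔮 P')))

/-- **The crux `PurityTransfer` conditional on the smooth-case fact `GrosSuwa1988_purity` only**
(Gersten purity for Kato's `H^{n+1}_p` at points of smooth schemes over perfect fields, symbolic form;
Gros–Suwa 1988, Thm. 1.4).  Same composition as `PurityTransfer_of_shiho2007`: valuative-criterion lift
(`exists_affineModel_regular_of_hasResolution`, where `R ⊆ O` is used), regular chart inside `O`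
(`stub_regularChart`), purity at the centre (`gerstenTransport_of_grosSuwa1988`), admissibility of the
prime divisors through the centre (`stub_heightOneValuationRing`, `placeOfPrime`), local domination.
[cite: GrosSuwa1988, Thm. 1.4; ZariskiSamuel1960, Ch. VI §14, Thm. 31] -/
theorem PurityTransfer_of_grosSuwa1988 (hGS : GrosSuwa1988_purity.{0}) : PurityTransfer := by
  intro p hp k K _ _ _ _ _ _hKfg O _hO R hR hRO hfr hres G N Unr α hdiv
  -- (1) landed: the valuative criterion of properness lifts `Spec O` to the regular model
  obtain ⟨A, hAO, hRA, hAfg, hreg⟩ :=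
    exists_affineModel_regular_of_hasResolution O R hRO hR hfr hres
  have hAfr : IsFractionRing A K := isFractionRing_of_le hRA hfr
  -- (2) spread regularity to an affine chart `A'` inside `O`
  obtain ⟨A', hAA', hA'O, hA'fg, hreg'⟩ := stub_regularChart k K O A hAO hAfg hAfr hreg
  haveI hA'fr : IsFractionRing A' K := isFractionRing_of_le hAA' hAfr
  -- (3) purity at the centre `𝔮 = 𝔪_O ∩ A'`, fed by the crux hypothesis at the places `A'_P`
  have key : α ∈ pairIntegral p (localizationIn K (centreIdeal A' O hA'O) : Set K) := by
    refine gerstenTransport_of_grosSuwa1988 hGS p hp k K A' hA'fg (centreIdeal A' O hA'O) (hreg' _) α ?_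
    intro P _ hP1 hPle
    have hPval : ValuationRing (Localization.AtPrime P) :=
      stub_heightOneValuationRing k K A' P (hreg' P) hP1
    exact hdiv (placeOfPrime A' P hPval) (algebraMap_mem_placeOfPrime A' P hPval)
      (isDiscreteValuationRing_placeOfPrime A' P hPval hA'fg (Ideal.ne_bot_of_height_eq_one hP1))
      ⟨A', hA'fg, le_placeOfPrime A' P hPval,
        fun x hx => exists_mul_eq_of_mem_placeOfPrime A' P hPval hx⟩
      (fun x hx => le_placeOfPrime A' P hPval (hAA' (hRA hx)))
      (fun x hxR hxW =>
        (mem_centreIdeal_iff_coe_mem_nonunits A' O hA'O ⟨x, hAA' (hRA hxR)⟩).mp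
          (hPle ((coe_mem_nonunits_placeOfPrime_iff A' P hPval ⟨x, hAA' (hRA hxR)⟩).mp hxW)))
  -- (4) local domination `A'_𝔮 ⊆ O` and monotonicity of `Unr`
  exact pairIntegral_mono p (localizationIn_centre_subset O A' hA'O) key

end Summit.ResolutionOfSingularities.ResolutionOfSingularities.Theorems.WildPurityPurityTransfer

end
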